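import Summits.Ventures.HSemireg.WedgeHankelRecurrenceGaussChristoffelComparison

/-!
# Venture HSemireg — **LEAST SQUARES: THE ORTHOGONAL (FOURIER) PARTIAL SUM IS THE BEST `L²(ν)` APPROXIMATION**: for a positive discrete measure `(ν, w)` with orthogonal polynomials `q_0, …, q_n`
# (`h_k = Σ_l ν_l q_k(w_l)²`) and ANY polynomial `P`, the partial sum `S_n P = Σ_{k≤n} c_k q_k`, `c_k = Σ_l ν_l P(w_l) q_k(w_l) ∕ h_k`, satisfies `P − S_n P ⟂` every `G` with `deg G ≤ n`, hence the
# Pythagorean identity `Σ ν (P − G)² = Σ ν (P − S_n P)² + Σ ν (S_n P − G)²`: `S_n P` minimises `Σ_l ν_l (P − G)(w_l)²` over `deg G ≤ n`, uniquely (Toepler ∕ Gram; Szegő)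

HONEST FRAMING. Part of the Lean index of the computation cell `pub-hsemireg` (seat p10 gen 43, Sunday typer «UNIFORM-IN-n»).  Real polynomials and finite sums only; no variety, no cohomology
theory, no sheaf, no Ext group and no semiregularity map is constructed here; nothing here says that HC / HC_CM / HC_AV holds; no Literature fact (unproved `Prop`) is declared or used.  Custodian
versions as in `WedgeHankelSiegelIdeal` (1/3).
SOURCES (cited).  G. Szegő, *Orthogonal Polynomials*, §3.1 (3.1.5)–(3.1.6) and Thm 3.1.2 context (orthogonal expansions, least squares ∕ Bessel); J. P. Gram, *Ueber die Entwickelung reeller Functionen in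
Reihen mittelst der Methode der kleinsten Quadrate*, J. reine angew. Math. 94 (1883) 41–73; P. L. Chebyshev, *Sur les fractions continues* (1855) (discrete least squares by orthogonal polynomials);
P. J. Davis, *Interpolation and Approximation* (1963), Thm 8.5.1–8.5.3; W. Gautschi, *Orthogonal Polynomials: Computation and Approximation* (2004), §1.1 ∕ §3.2.1 (least squares approximation).
PROOF TYPED HERE.  `Σ ν (P − S) q_k = Σ ν P q_k − c_k h_k = 0` by pairwise orthogonality; a general `G` with `deg G ≤ n` is expanded on the nodes through N277 `kernel_reproducing_eval`
(`G(w_l) = Σ_k d_k q_k(w_l)`), so `Σ ν (P − S) G = 0`; then `(P − G) = (P − S) + (S − G)` and the cross term vanishes (`deg (S − G) ≤ n`); uniqueness by N273 `eq_zero_of_sum_mul_eval_sq_eq_zero`.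
DEDUP DISCLOSURE (`rg -n 'least_squares|fourier_partial|bessel' Summits/Ventures/HSemireg`, 2026-09-03): N275 (`GaussExtremal`) is the extremal property of the MONIC orthogonal polynomial (`min Σ ν Q²`), a
different problem; nothing on Fourier partial sums.  The 5 names below: 0 hits tree-wide.

WHAT IS IN THE TREE.  N277 `kernel_reproducing_eval`, `natDegree_reproducingKernel_le`; N273 `eq_zero_of_sum_mul_eval_sq_eq_zero`, `sum_mul_eval_sq_pos_of_natDegree_lt`; Mathlib `Finset.sum_comm`,
`eval_finsetSum`.
THIS FILE (namespace `Summit.Ventures.HSemireg.Wedge.HankelOuter` continued; CHAINED on N316 (import), N273, N277; 0 definitions — `S_n P` is the inline polynomial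
`Σ_{k ∈ range (n+1)} C ((Σ_l ν_l P(w_l) q_k(w_l)) ∕ h_k) · q_k`):
* §1082 `fourier_partialSum_orthogonal_basis` (`Σ ν (P − S_n P) q_k = 0`, `k ≤ n`), **`fourier_partialSum_orthogonal`** (`Σ ν (P − S_n P) G = 0` for `deg G ≤ n`), **`least_squares_pythagoras`**
  (`Σ ν (P − G)² = Σ ν (P − S_n P)² + Σ ν (S_n P − G)²`), **`least_squares_partialSum_le`** (minimality), **`least_squares_unique`** (equality forces `G = S_n P`).
CAVEATS.  Positive discrete measures with `N > n` atoms.  Nothing Ext-side.  New names only.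
-/

open Module Polynomial
open scoped Matrix Polynomial

namespace Summit.Ventures.HSemireg.Wedge.HankelOuter

/-! ## §1082. Least squares by the orthogonal partial sum -/

/-- **`P − S_n P ⟂ q_k` for `k ≤ n`**, `S_n P = Σ_{j≤n} c_j q_j`, `c_j = Σ_l ν_l P(w_l) q_j(w_l) ∕ h_j` (pairwise orthogonality of the `q_j`, `h_j ≠ 0`). [Szegő (3.1.5); Gram 1883; this file, §1082] -/
theorem fourier_partialSum_orthogonal_basis {N n : ℕ} {ν w : Fin N → ℝ} {q : ℕ → ℝ[X]} (hdeg : ∀ k, k ≤ n → (q k).natDegree = k)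
    (horth : ∀ k, k ≤ n → ∀ G : ℝ[X], G.natDegree < k → ∑ l, ν l * (q k * G).eval (w l) = 0) (hh : ∀ k, k ≤ n → ∑ l, ν l * ((q k).eval (w l)) ^ 2 ≠ 0)
    (P : ℝ[X]) {k : ℕ} (hk : k ≤ n) :
    ∑ l, ν l * ((P - ∑ j ∈ Finset.range (n + 1), C ((∑ l', ν l' * (P.eval (w l') * (q j).eval (w l'))) / ∑ l', ν l' * ((q j).eval (w l')) ^ 2) * q j).eval (w l) * (q k).eval (w l)) = 0 := by
  -- pairwise orthogonality `Σ ν q_j q_k = δ_{jk} h_k`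
  have hpair : ∀ j, j ≤ n → j ≠ k → ∑ l, ν l * ((q j).eval (w l) * (q k).eval (w l)) = 0 := by
    intro j hj hjk
    rcases lt_or_gt_of_ne hjk with hlt | hgt
    · have := horth k hk (q j) (by rw [hdeg j hj]; exact hlt)
      rw [← this]; exact Finset.sum_congr rfl fun l _ => by rw [eval_mul, mul_comm ((q j).eval _)]
    · have := horth j hj (q k) (by rw [hdeg k hk]; exact hgt)
      rw [← this]; exact Finset.sum_congr rfl fun l _ => by rw [eval_mul]
  set c : ℕ → ℝ := fun j => (∑ l', ν l' * (P.eval (w l') * (q j).eval (w l'))) / ∑ l', ν l' * ((q j).eval (w l')) ^ 2 with hc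
  -- expand `(P − S)(w) q_k(w)` and sum
  have hl : ∀ l, ν l * ((P - ∑ j ∈ Finset.range (n + 1), C (c j) * q j).eval (w l) * (q k).eval (w l)) =
      ν l * (P.eval (w l) * (q k).eval (w l)) - ∑ j ∈ Finset.range (n + 1), c j * (ν l * ((q j).eval (w l) * (q k).eval (w l))) := fun l => by
    rw [eval_sub, eval_finsetSum, sub_mul, mul_sub, Finset.sum_mul, Finset.mul_sum]
    congr 1
    exact Finset.sum_congr rfl fun j _ => by rw [eval_mul, eval_C]; ring
  rw [Finset.sum_congr rfl fun l _ => hl l, Finset.sum_sub_distrib, Finset.sum_comm]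
  simp only [← Finset.mul_sum]
  rw [Finset.sum_eq_single_of_mem k (Finset.mem_range.2 (by omega)) fun j hj hjk => by rw [hpair j (Nat.lt_succ_iff.1 (Finset.mem_range.1 hj)) hjk, mul_zero]]
  have hsq : ∑ l, ν l * ((q k).eval (w l) * (q k).eval (w l)) = ∑ l, ν l * ((q k).eval (w l)) ^ 2 := Finset.sum_congr rfl fun l _ => by rw [sq]
  rw [hsq, hc]
  simp only
  rw [div_mul_cancel₀ _ (hh k hk), sub_self]

/-- **`P − S_n P ⟂ G` for every `G` with `deg G ≤ n`** (expand `G` on the nodes by the reproducing kernel, N277). [Szegő §3.1; Davis Thm 8.5.1; this file, §1082] -/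
theorem fourier_partialSum_orthogonal {N n : ℕ} {ν w : Fin N → ℝ} {q : ℕ → ℝ[X]} (hmonic : ∀ k, k ≤ n → (q k).Monic) (hdeg : ∀ k, k ≤ n → (q k).natDegree = k)
    (horth : ∀ k, k ≤ n → ∀ G : ℝ[X], G.natDegree < k → ∑ l, ν l * (q k * G).eval (w l) = 0) (hh : ∀ k, k ≤ n → ∑ l, ν l * ((q k).eval (w l)) ^ 2 ≠ 0)
    (P : ℝ[X]) {G : ℝ[X]} (hG : G.natDegree ≤ n) :
    ∑ l, ν l * ((P - ∑ j ∈ Finset.range (n + 1), C ((∑ l', ν l' * (P.eval (w l') * (q j).eval (w l'))) / ∑ l', ν l' * ((q j).eval (w l')) ^ 2) * q j).eval (w l) * G.eval (w l)) = 0 := by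
  set R : ℝ[X] := P - ∑ j ∈ Finset.range (n + 1), C ((∑ l', ν l' * (P.eval (w l') * (q j).eval (w l'))) / ∑ l', ν l' * ((q j).eval (w l')) ^ 2) * q j with hR
  -- `G(w_l) = Σ_k d_k q_k(w_l)` with `d_k = Σ_{l'} ν q_k(w_{l'}) G(w_{l'}) ∕ h_k`
  have hexp : ∀ l, G.eval (w l) = ∑ k ∈ Finset.range (n + 1), (∑ l', ν l' * ((q k).eval (w l') * G.eval (w l'))) / (∑ l', ν l' * ((q k).eval (w l')) ^ 2) * (q k).eval (w l) := fun l => by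
    rw [← kernel_reproducing_eval hmonic hdeg horth hh le_rfl hG (w l)]
    simp only [Finset.sum_mul, Finset.mul_sum, Finset.sum_div]
    rw [Finset.sum_comm]
    exact Finset.sum_congr rfl fun k _ => Finset.sum_congr rfl fun l' _ => by ring
  have hbasis : ∀ k, k ≤ n → ∑ l, ν l * (R.eval (w l) * (q k).eval (w l)) = 0 := fun k hk => fourier_partialSum_orthogonal_basis hdeg horth hh P hk
  calc ∑ l, ν l * (R.eval (w l) * G.eval (w l))
      = ∑ l, ∑ k ∈ Finset.range (n + 1), (∑ l', ν l' * ((q k).eval (w l') * G.eval (w l'))) / (∑ l', ν l' * ((q k).eval (w l')) ^ 2) * (ν l * (R.eval (w l) * (q k).eval (w l))) := by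
        refine Finset.sum_congr rfl fun l _ => ?_
        rw [hexp l, Finset.mul_sum, Finset.mul_sum]
        exact Finset.sum_congr rfl fun k _ => by ring
    _ = 0 := by
        rw [Finset.sum_comm]
        refine Finset.sum_eq_zero fun k hk => ?_
        rw [← Finset.mul_sum, hbasis k (Nat.lt_succ_iff.1 (Finset.mem_range.1 hk)), mul_zero]

/-- **PYTHAGORAS: `Σ ν (P − G)² = Σ ν (P − S_n P)² + Σ ν (S_n P − G)²`** for every `G` with `deg G ≤ n`. [Szegő §3.1; Gram 1883; Davis Thm 8.5.2; this file, §1082] -/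
theorem least_squares_pythagoras {N n : ℕ} {ν w : Fin N → ℝ} {q : ℕ → ℝ[X]} (hmonic : ∀ k, k ≤ n → (q k).Monic) (hdeg : ∀ k, k ≤ n → (q k).natDegree = k)
    (horth : ∀ k, k ≤ n → ∀ G : ℝ[X], G.natDegree < k → ∑ l, ν l * (q k * G).eval (w l) = 0) (hh : ∀ k, k ≤ n → ∑ l, ν l * ((q k).eval (w l)) ^ 2 ≠ 0)
    (P : ℝ[X]) {G : ℝ[X]} (hG : G.natDegree ≤ n) :
    ∑ l, ν l * ((P - G).eval (w l)) ^ 2 =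
      ∑ l, ν l * ((P - ∑ j ∈ Finset.range (n + 1), C ((∑ l', ν l' * (P.eval (w l') * (q j).eval (w l'))) / ∑ l', ν l' * ((q j).eval (w l')) ^ 2) * q j).eval (w l)) ^ 2 +
        ∑ l, ν l * ((∑ j ∈ Finset.range (n + 1), C ((∑ l', ν l' * (P.eval (w l') * (q j).eval (w l'))) / ∑ l', ν l' * ((q j).eval (w l')) ^ 2) * q j - G).eval (w l)) ^ 2 := by
  set S : ℝ[X] := ∑ j ∈ Finset.range (n + 1), C ((∑ l', ν l' * (P.eval (w l') * (q j).eval (w l'))) / ∑ l', ν l' * ((q j).eval (w l')) ^ 2) * q j with hS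
  have hSd : (S - G).natDegree ≤ n := by
    refine (natDegree_sub_le _ _).trans (max_le ?_ hG)
    exact natDegree_sum_le_of_forall_le _ _ fun j hj =>
      (natDegree_C_mul_le _ _).trans (by rw [hdeg j (Nat.lt_succ_iff.1 (Finset.mem_range.1 hj))]; exact Nat.lt_succ_iff.1 (Finset.mem_range.1 hj))
  have hcross := fourier_partialSum_orthogonal hmonic hdeg horth hh P hSd
  have hl : ∀ l, ν l * ((P - G).eval (w l)) ^ 2 = ν l * ((P - S).eval (w l)) ^ 2 + ν l * ((S - G).eval (w l)) ^ 2 + 2 * (ν l * ((P - S).eval (w l) * (S - G).eval (w l))) := fun l => by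
    simp only [eval_sub]; ring
  rw [Finset.sum_congr rfl fun l _ => hl l, Finset.sum_add_distrib, Finset.sum_add_distrib, ← Finset.mul_sum, hcross, mul_zero, add_zero]

/-- **LEAST SQUARES: `S_n P` minimises `Σ_l ν_l (P − G)(w_l)²` over `deg G ≤ n`** (`ν ≥ 0`). [Szegő §3.1; Chebyshev 1855; Gram 1883; Davis Thm 8.5.2; Gautschi §1.1; this file, §1082] -/
theorem least_squares_partialSum_le {N n : ℕ} {ν w : Fin N → ℝ} (hν : ∀ l, 0 ≤ ν l) {q : ℕ → ℝ[X]} (hmonic : ∀ k, k ≤ n → (q k).Monic) (hdeg : ∀ k, k ≤ n → (q k).natDegree = k)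
    (horth : ∀ k, k ≤ n → ∀ G : ℝ[X], G.natDegree < k → ∑ l, ν l * (q k * G).eval (w l) = 0) (hh : ∀ k, k ≤ n → ∑ l, ν l * ((q k).eval (w l)) ^ 2 ≠ 0)
    (P : ℝ[X]) {G : ℝ[X]} (hG : G.natDegree ≤ n) :
    ∑ l, ν l * ((P - ∑ j ∈ Finset.range (n + 1), C ((∑ l', ν l' * (P.eval (w l') * (q j).eval (w l'))) / ∑ l', ν l' * ((q j).eval (w l')) ^ 2) * q j).eval (w l)) ^ 2 ≤
      ∑ l, ν l * ((P - G).eval (w l)) ^ 2 := by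
  rw [least_squares_pythagoras hmonic hdeg horth hh P hG]
  exact le_add_of_nonneg_right (Finset.sum_nonneg fun l _ => mul_nonneg (hν l) (sq_nonneg _))

/-- **… and uniquely**: if `deg G ≤ n < N` and `Σ ν (P − G)² = Σ ν (P − S_n P)²` (`ν > 0`, distinct nodes), then `G = S_n P`. [Davis Thm 8.5.3; this file, §1082] -/
theorem least_squares_unique {N n : ℕ} {ν w : Fin N → ℝ} (hν : ∀ l, 0 < ν l) (hw : Function.Injective w) (hnN : n < N) {q : ℕ → ℝ[X]}
    (hmonic : ∀ k, k ≤ n → (q k).Monic) (hdeg : ∀ k, k ≤ n → (q k).natDegree = k)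
    (horth : ∀ k, k ≤ n → ∀ G : ℝ[X], G.natDegree < k → ∑ l, ν l * (q k * G).eval (w l) = 0) (P : ℝ[X]) {G : ℝ[X]} (hG : G.natDegree ≤ n)
    (heq : ∑ l, ν l * ((P - G).eval (w l)) ^ 2 =
      ∑ l, ν l * ((P - ∑ j ∈ Finset.range (n + 1), C ((∑ l', ν l' * (P.eval (w l') * (q j).eval (w l'))) / ∑ l', ν l' * ((q j).eval (w l')) ^ 2) * q j).eval (w l)) ^ 2) :
    G = ∑ j ∈ Finset.range (n + 1), C ((∑ l', ν l' * (P.eval (w l') * (q j).eval (w l'))) / ∑ l', ν l' * ((q j).eval (w l')) ^ 2) * q j := by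
  have hh : ∀ k, k ≤ n → ∑ l, ν l * ((q k).eval (w l)) ^ 2 ≠ 0 := fun k hk =>
    (sum_mul_eval_sq_pos_of_natDegree_lt hν hw (hmonic k hk).ne_zero (by rw [hdeg k hk]; omega)).ne'
  have hpy := least_squares_pythagoras hmonic hdeg horth hh P hG
  rw [heq] at hpy
  have hzero : ∑ l, ν l * ((∑ j ∈ Finset.range (n + 1), C ((∑ l', ν l' * (P.eval (w l') * (q j).eval (w l'))) / ∑ l', ν l' * ((q j).eval (w l')) ^ 2) * q j - G).eval (w l)) ^ 2 = 0 := by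
    linarith
  have hSd : (∑ j ∈ Finset.range (n + 1), C ((∑ l', ν l' * (P.eval (w l') * (q j).eval (w l'))) / ∑ l', ν l' * ((q j).eval (w l')) ^ 2) * q j - G).natDegree < N := by
    refine lt_of_le_of_lt ((natDegree_sub_le _ _).trans (max_le ?_ hG)) hnN
    exact natDegree_sum_le_of_forall_le _ _ fun j hj =>
      (natDegree_C_mul_le _ _).trans (by rw [hdeg j (Nat.lt_succ_iff.1 (Finset.mem_range.1 hj))]; exact Nat.lt_succ_iff.1 (Finset.mem_range.1 hj))
  have h := eq_zero_of_sum_mul_eval_sq_eq_zero hν hw hSd hzero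
  exact (sub_eq_zero.1 h).symm

end Summit.Ventures.HSemireg.Wedge.HankelOuter
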